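import Literature.NumberTheory.Automorphic.WhittakerTowerParseval
import Literature.NumberTheory.Automorphic.CuspidalWhittakerGL2
import HarnessLib

/-!
# The Rankin–Selberg unfolding identity for a PAIR of cusp forms at a real point, by polarization
(Jacquet–Shalika (1981), §4; Cogdell (2004), §2.3, Thm. 2.1: `I(s; φ, φ', Φ) = Ψ(s; W_φ, W'_{φ'}, Φ)`)

Topic `NumberTheory/Automorphic`; namespace `Literature.NumberTheory.Automorphic`. Two definitions
and theorems. `WhittakerTowerParseval` proves the unfolding identity of the real-point Rankin–Selberg
method for ONE cusp form `φ` against its conjugate — in `[0, ∞]`: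

  `C · Ψ(σ; W_φ, W̄_φ, Φ) = ∫ ‖φ‖² E_w β_{GL_n(K)} dν`

(`exists_mul_rankinSelbergTorusIntegral_eq_lintegral_eisensteinWeight`: `Ψ = rankinSelbergTorusIntegral`,
the unfolded integral `∫_{(𝔸ˣ)ⁿ × K} |W(diag(a) k)|² Φ(e_n diag(a) k) |det a|^σ δ_B(a)⁻¹` in torus
coordinates, `E_w = eisensteinWeight Φ σ` the incomplete Eisenstein sum of `Φ(e_n g) |det g|^σ`, `β` a
`GL_n(K)`-covering weight, `W_φ = whittakerCoeff` the global Whittaker coefficient). The printed identity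
is for a pair: `φ ∈ π` and `φ' ∈ π'` two cusp forms, `I(s; φ, φ', Φ) = Ψ(s; W_φ, W'_{φ'}, Φ)` with
`W'_{φ'}` the `ψ⁻¹`-Whittaker function of `φ'` (Cogdell (2004), Thm. 2.1; Jacquet–Shalika (1981), §4,
(4.4)) — this is what every statement about `L(s, π × π')` with `π' ≇ π̃` consumes (Cogdell, Thm. 2.2,
§4.2; Arthur–Clozel (1989), Ch. 3, (2.2)). Both sides of the pair identity are **bilinear** in
`(φ, φ')`, and the one-form identity is its restriction to the anti-diagonal `φ' = φ̄`; so the pair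
identity follows from the one-form identity for the four cusp forms `φ ± φ̄'`, `φ ± i φ̄'` by the
**polarization identity** `x ȳ = ¼ (|x + y|² - |x - y|² + i |x + i y|² - i |x - i y|²)`, as soon as all
the integrals are finite. This file carries this out:

* `torusPairIntegrand`, `rankinSelbergTorusPairIntegral νA νK W W' Φ σ` (**definitions**) — the
  unfolded Rankin–Selberg integral of a PAIR of Whittaker functions at a real point,
  `Ψ(σ; W, W', Φ) = ∫_{(𝔸ˣ)ⁿ × K} W(diag(a) k) W'(diag(a) k) Φ(e_n diag(a) k) |det a|^σ δ_B(a)⁻¹`, a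
  Bochner integral (`W'` plays the part of the `ψ⁻¹`-Whittaker function; for `W' = W̄` the integrand is
  the real one, `torusPairIntegrand_self_star`, and the integral is the real one,
  `rankinSelbergTorusPairIntegral_self_star`);
* `mul_conj_eq_polarization` — the polarization identity in `ℂ`;
  `integral_mul_conj_mul_eq_polarization` — its integrated form against a real weight;
* `rankinSelbergTorusIntegral_ne_top_of_unfolding` — finiteness of `Ψ(σ; W_φ, W̄_φ, Φ)` from finiteness
  of `∫ ‖φ‖² E_w β` (the identity, `C ≠ 0`);
* `whittakerCoeff_add_const_mul` — `W_{φ + c φ'} = W_φ + c W_{φ'}`;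
* `exists_mul_rankinSelbergTorusPairIntegral_eq_integral_eisensteinWeight` (**main**) — **the
  unfolding identity for pairs at a real point**: with the same constant `C ∈ (0, ∞)` as the one-form
  identity, for all continuous, left `GL_n(K)`-invariant, cuspidal `φ`, `φ'` on `GL_n(𝔸_K)` with
  `∫ ‖φ‖² E_w β`, `∫ ‖φ'‖² E_w β < ∞`,

    `C · Ψ(σ; W_φ, W̄_{φ'}, Φ) = ∫ φ φ̄' E_w β dν`  in `ℂ`

  (`W̄_{φ'} = star (whittakerCoeff … φ')` is the `ψ̄`-Whittaker coefficient of the cusp form `φ̄'`).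
  With `φ ∈ π` and `φ̄' ∈ σ` this is Cogdell's `I = Ψ` for the pair `(π, σ)` before the integration
  over the centre, in the tree's covering-weight form.

Not here: the Euler factorisation of `Ψ(σ; W, W', Φ)` for Hecke–Whittaker data of two different
representations (the Cauchy identity for two alphabets, `hasSum_shintaniPair`), and the passage from
the group to the automorphic quotient (`RankinSelbergQuotientUnfolding`, likewise by linearity).

## References

* J. W. Cogdell, *Analytic theory of L-functions for GL_n*, in J. Bernstein, S. Gelbart (eds.), *An
  Introduction to the Langlands Program* (2004), §2.3, Thm. 2.1 [CogdellAnalyticTheory2004].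
* H. Jacquet, J. A. Shalika, *On Euler products and the classification of automorphic
  representations I*, Amer. J. Math. 103 (1981), 499–558, §4 [JacquetShalikaAJM1981].
-/

noncomputable section

open MeasureTheory Measure NumberField IsDedekindDomain Matrix Set Filter Topology
open scoped MatrixGroups ENNReal NNReal ComplexConjugate
open Literature.MeasureTheory.Group
open Literature.NumberTheory.GaloisRepresentations (ideleGroup)

namespace Literature.NumberTheory.Automorphic

/-! ### Polarization -/

section Polarization

open Complex

/-- **The polarization identity in `ℂ`**: `x ȳ = ¼ (|x + y|² - |x - y|² + i |x + i y|² - i |x - i y|²)`.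
[folklore] -/
theorem mul_conj_eq_polarization (x y : ℂ) :
    x * conj y = (1 / 4 : ℂ) * (((‖x + y‖ ^ 2 : ℝ) : ℂ) - ((‖x - y‖ ^ 2 : ℝ) : ℂ) +
      I * ((‖x + I * y‖ ^ 2 : ℝ) : ℂ) - I * ((‖x - I * y‖ ^ 2 : ℝ) : ℂ)) := by
  simp only [Complex.sq_norm, Complex.normSq_apply]
  apply Complex.ext
  · simp; ring
  · simp; ring

variable {X : Type*} [MeasurableSpace X] {m : Measure X}

/-- **Polarization of a weighted integral**: if the four functions `‖f + c g‖² w`, `c ∈ {1, -1, i, -i}`,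
are integrable then `∫ f ḡ w = ¼ (∫ ‖f + g‖² w - ∫ ‖f - g‖² w + i ∫ ‖f + i g‖² w - i ∫ ‖f - i g‖² w)`.
[folklore] -/
theorem integral_mul_conj_mul_eq_polarization {f g : X → ℂ} {w : X → ℝ}
    (h₁ : Integrable (fun x => ‖f x + g x‖ ^ 2 * w x) m)
    (h₂ : Integrable (fun x => ‖f x - g x‖ ^ 2 * w x) m)
    (h₃ : Integrable (fun x => ‖f x + I * g x‖ ^ 2 * w x) m)
    (h₄ : Integrable (fun x => ‖f x - I * g x‖ ^ 2 * w x) m) :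
    ∫ x, f x * conj (g x) * (w x : ℂ) ∂m =
      (1 / 4 : ℂ) * ((∫ x, ‖f x + g x‖ ^ 2 * w x ∂m : ℝ) - (∫ x, ‖f x - g x‖ ^ 2 * w x ∂m : ℝ) +
        I * (∫ x, ‖f x + I * g x‖ ^ 2 * w x ∂m : ℝ) - I * (∫ x, ‖f x - I * g x‖ ^ 2 * w x ∂m : ℝ)) := by
  have hpt : ∀ x, f x * conj (g x) * (w x : ℂ) =
      (1 / 4 : ℂ) * ((((‖f x + g x‖ ^ 2 * w x : ℝ)) : ℂ) - (((‖f x - g x‖ ^ 2 * w x : ℝ)) : ℂ) +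
        I * (((‖f x + I * g x‖ ^ 2 * w x : ℝ)) : ℂ) - I * (((‖f x - I * g x‖ ^ 2 * w x : ℝ)) : ℂ)) := by
    intro x
    rw [mul_conj_eq_polarization]
    push_cast
    ring
  simp_rw [hpt]
  have h₁' : Integrable (fun x => (((‖f x + g x‖ ^ 2 * w x : ℝ)) : ℂ)) m := h₁.ofReal
  have h₂' : Integrable (fun x => (((‖f x - g x‖ ^ 2 * w x : ℝ)) : ℂ)) m := h₂.ofReal
  have h₃' : Integrable (fun x => I * (((‖f x + I * g x‖ ^ 2 * w x : ℝ)) : ℂ)) m := h₃.ofReal.const_mul I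
  have h₄' : Integrable (fun x => I * (((‖f x - I * g x‖ ^ 2 * w x : ℝ)) : ℂ)) m := h₄.ofReal.const_mul I
  have hA : Integrable (fun x => (((‖f x + g x‖ ^ 2 * w x : ℝ)) : ℂ) - (((‖f x - g x‖ ^ 2 * w x : ℝ)) : ℂ)) m :=
    h₁'.sub h₂'
  have hB : Integrable (fun x => (((‖f x + g x‖ ^ 2 * w x : ℝ)) : ℂ) - (((‖f x - g x‖ ^ 2 * w x : ℝ)) : ℂ) +
      I * (((‖f x + I * g x‖ ^ 2 * w x : ℝ)) : ℂ)) m := hA.add h₃'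
  rw [integral_const_mul, integral_sub hB h₄', integral_add hA h₃', integral_sub h₁' h₂', integral_const_mul,
    integral_const_mul, integral_complex_ofReal, integral_complex_ofReal, integral_complex_ofReal,
    integral_complex_ofReal]

end Polarization

/-! ### The unfolded Rankin–Selberg integral of a pair -/

section PairIntegral

variable (n : ℕ) (K : Type) [Field K] [NumberField K]

/-- The **integrand of the unfolded Rankin–Selberg integral of a pair** at a real point `σ`, in torus
coordinates: `(a, k) ↦ W(diag(a) k) W'(diag(a) k) Φ(e_n diag(a) k) |det a|^σ δ_B(a)⁻¹ ∈ ℂ`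
(Cogdell (2004), §2.3, the integrand of `Ψ(s; W_φ, W'_{φ'}, Φ)` after the Iwasawa decomposition).
[cite: CogdellAnalyticTheory2004, §2.3 Thm. 2.1] -/
def torusPairIntegrand (W W' : GL (Fin n) (AdeleRing (𝓞 K) K) → ℂ) (Φ : (Fin n → AdeleRing (𝓞 K) K) → ℝ)
    (σ : ℝ) (p : (Fin n → ideleGroup K) × ↥(maximalCompactAdelic n K)) : ℂ :=
  W (torusPoint n K p) * W' (torusPoint n K p) *
    ((Φ (lastRow n K (torusPoint n K p)) * torusWeight n K σ p.1 : ℝ) : ℂ)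

variable [MeasurableSpace (ideleGroup K)] [MeasurableSpace (AdelicGroupData.gl n K).Adelic]

/-- **The unfolded Rankin–Selberg integral of a pair of Whittaker functions at a real point `σ`**:
`Ψ(σ; W, W', Φ) = ∫_{(𝔸ˣ)ⁿ × K} W(diag(a) k) W'(diag(a) k) Φ(e_n diag(a) k) |det a|^σ δ_B(a)⁻¹ dνA dνK`, a
Bochner integral (value `0` when not integrable; it is integrable when the real integrals of `W` and of
`W'` are finite, `integrable_torusPairIntegrand`). This is `Ψ(s; W, W', Φ)` of Jacquet–Shalika (1981),
§4, (4.4) / Cogdell (2004), Thm. 2.1 at `s = σ`, with `W'` in the part of the `ψ⁻¹`-Whittaker function,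
written through the Iwasawa decomposition; for `W' = W̄` it is the real-point integral
`rankinSelbergTorusIntegral` (`rankinSelbergTorusPairIntegral_self_star`). [cite: CogdellAnalyticTheory2004, §2.3 Thm. 2.1] -/
def rankinSelbergTorusPairIntegral (νA : Measure (Fin n → ideleGroup K))
    (νK : Measure ↥(maximalCompactAdelic n K)) (W W' : GL (Fin n) (AdeleRing (𝓞 K) K) → ℂ)
    (Φ : (Fin n → AdeleRing (𝓞 K) K) → ℝ) (σ : ℝ) : ℂ :=
  ∫ p, torusPairIntegrand n K W W' Φ σ p ∂(νA.prod νK)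

end PairIntegral

section PairLemmas

variable {n : ℕ} {K : Type} [Field K] [NumberField K]

/-- For `W' = W̄` the pair integrand is the real one: `W W̄ Φ w = |W|² Φ w` (`Φ ≥ 0`). [folklore] -/
theorem torusPairIntegrand_self_star {W : GL (Fin n) (AdeleRing (𝓞 K) K) → ℂ}
    {Φ : (Fin n → AdeleRing (𝓞 K) K) → ℝ} (hΦ : ∀ y, 0 ≤ Φ y) (σ : ℝ)
    (p : (Fin n → ideleGroup K) × ↥(maximalCompactAdelic n K)) :
    torusPairIntegrand n K W (star W) Φ σ p = ((torusIntegrand n K W Φ σ p).toReal : ℂ) := by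
  unfold torusPairIntegrand torusIntegrand
  rw [ENNReal.toReal_ofReal (mul_nonneg (mul_nonneg (sq_nonneg _) (hΦ _)) (torusWeight_pos σ p.1).le),
    Pi.star_apply, Complex.star_def, Complex.mul_conj, Complex.normSq_eq_norm_sq]
  push_cast
  ring

/-- The pair integrand with `W' = W̄` as a real function: `‖W‖² Φ w = toReal (torusIntegrand)`. [folklore] -/
theorem norm_sq_mul_eq_toReal_torusIntegrand {W : GL (Fin n) (AdeleRing (𝓞 K) K) → ℂ}
    {Φ : (Fin n → AdeleRing (𝓞 K) K) → ℝ} (hΦ : ∀ y, 0 ≤ Φ y) (σ : ℝ)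
    (p : (Fin n → ideleGroup K) × ↥(maximalCompactAdelic n K)) :
    ‖W (torusPoint n K p)‖ ^ 2 * (Φ (lastRow n K (torusPoint n K p)) * torusWeight n K σ p.1) =
      (torusIntegrand n K W Φ σ p).toReal := by
  unfold torusIntegrand
  rw [ENNReal.toReal_ofReal (mul_nonneg (mul_nonneg (sq_nonneg _) (hΦ _)) (torusWeight_pos σ p.1).le),
    mul_assoc]

variable [MeasurableSpace (ideleGroup K)] [BorelSpace (ideleGroup K)]

attribute [local instance] adelicBorel borelSpace_adelic glAdeleBorel borelSpace_glAdele

/-- Measurability of the complex pair integrand for continuous `W`, `W'`. [folklore] -/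
theorem measurable_torusPairIntegrand {W W' : GL (Fin n) (AdeleRing (𝓞 K) K) → ℂ} (hW : Continuous W)
    (hW' : Continuous W') {Φ : (Fin n → AdeleRing (𝓞 K) K) → ℝ}
    (hΦm : Measurable fun g : GL (Fin n) (AdeleRing (𝓞 K) K) => Φ (lastRow n K g)) (σ : ℝ) :
    Measurable (torusPairIntegrand n K W W' Φ σ) := by
  haveI := secondCountableTopology_ideleGroup K
  haveI : SecondCountableTopology (GL (Fin n) (AdeleRing (𝓞 K) K)) :=
    secondCountableTopology_generalLinearGroup_adeleRing K (Fin n)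
  haveI : SecondCountableTopology (AdelicGroupData.gl n K).Adelic :=
    secondCountableTopology_generalLinearGroup_adeleRing K (Fin n)
  haveI : SecondCountableTopology ↥(maximalCompactAdelic n K) :=
    TopologicalSpace.Subtype.secondCountableTopology _
  unfold torusPairIntegrand
  have hpt : Measurable (torusPoint n K) := continuous_torusPoint.measurable
  refine ((hW.measurable.comp hpt).mul (hW'.measurable.comp hpt)).mul ?_
  exact Complex.measurable_ofReal.comp ((hΦm.comp hpt).mul
    ((continuous_torusWeight σ).measurable.comp measurable_fst))

/-- **Integrability of the real integrand from finiteness of the real integral.** [folklore] -/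
theorem integrable_toReal_torusIntegrand (νA : Measure (Fin n → ideleGroup K))
    (νK : Measure ↥(maximalCompactAdelic n K)) {W : GL (Fin n) (AdeleRing (𝓞 K) K) → ℂ}
    (hW : Continuous W) {Φ : (Fin n → AdeleRing (𝓞 K) K) → ℝ}
    (hΦm : Measurable fun g : GL (Fin n) (AdeleRing (𝓞 K) K) => Φ (lastRow n K g)) (σ : ℝ)
    (hfin : rankinSelbergTorusIntegral n K νA νK W Φ σ ≠ ⊤) :
    Integrable (fun p => (torusIntegrand n K W Φ σ p).toReal) (νA.prod νK) :=
  integrable_toReal_of_lintegral_ne_top (measurable_torusIntegrand hW hΦm σ).aemeasurable hfin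

/-- **The pair integrand is integrable when the two real integrals are finite**
(`|W W'| Φ w ≤ ½ (|W|² + |W'|²) Φ w`). [folklore] -/
theorem integrable_torusPairIntegrand (νA : Measure (Fin n → ideleGroup K))
    (νK : Measure ↥(maximalCompactAdelic n K)) {W W' : GL (Fin n) (AdeleRing (𝓞 K) K) → ℂ}
    (hW : Continuous W) (hW' : Continuous W') {Φ : (Fin n → AdeleRing (𝓞 K) K) → ℝ} (hΦ : ∀ y, 0 ≤ Φ y)
    (hΦm : Measurable fun g : GL (Fin n) (AdeleRing (𝓞 K) K) => Φ (lastRow n K g)) (σ : ℝ)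
    (hfin : rankinSelbergTorusIntegral n K νA νK W Φ σ ≠ ⊤)
    (hfin' : rankinSelbergTorusIntegral n K νA νK W' Φ σ ≠ ⊤) :
    Integrable (torusPairIntegrand n K W W' Φ σ) (νA.prod νK) := by
  refine Integrable.mono' (((integrable_toReal_torusIntegrand νA νK hW hΦm σ hfin).add
    (integrable_toReal_torusIntegrand νA νK hW' hΦm σ hfin')).div_const 2)
    (measurable_torusPairIntegrand hW hW' hΦm σ).aestronglyMeasurable (Eventually.of_forall fun p => ?_)
  change ‖torusPairIntegrand n K W W' Φ σ p‖ ≤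
    ((torusIntegrand n K W Φ σ p).toReal + (torusIntegrand n K W' Φ σ p).toReal) / 2
  rw [← norm_sq_mul_eq_toReal_torusIntegrand hΦ, ← norm_sq_mul_eq_toReal_torusIntegrand hΦ]
  have hw : 0 ≤ Φ (lastRow n K (torusPoint n K p)) * torusWeight n K σ p.1 :=
    mul_nonneg (hΦ _) (torusWeight_pos σ p.1).le
  unfold torusPairIntegrand
  rw [norm_mul, norm_mul, Complex.norm_real, Real.norm_of_nonneg hw]
  nlinarith [two_mul_le_add_sq ‖W (torusPoint n K p)‖ ‖W' (torusPoint n K p)‖,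
    mul_nonneg (mul_nonneg (norm_nonneg (W (torusPoint n K p))) (norm_nonneg (W' (torusPoint n K p)))) hw,
    sq_nonneg ‖W (torusPoint n K p)‖, sq_nonneg ‖W' (torusPoint n K p)‖]

/-- **For `W' = W̄` the pair integral is the real-point integral** (finite case). [folklore] -/
theorem rankinSelbergTorusPairIntegral_self_star (νA : Measure (Fin n → ideleGroup K))
    (νK : Measure ↥(maximalCompactAdelic n K)) {W : GL (Fin n) (AdeleRing (𝓞 K) K) → ℂ}
    (hW : Continuous W) {Φ : (Fin n → AdeleRing (𝓞 K) K) → ℝ} (hΦ : ∀ y, 0 ≤ Φ y)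
    (hΦm : Measurable fun g : GL (Fin n) (AdeleRing (𝓞 K) K) => Φ (lastRow n K g)) (σ : ℝ)
    (hfin : rankinSelbergTorusIntegral n K νA νK W Φ σ ≠ ⊤) :
    rankinSelbergTorusPairIntegral n K νA νK W (star W) Φ σ =
      ((rankinSelbergTorusIntegral n K νA νK W Φ σ).toReal : ℂ) := by
  unfold rankinSelbergTorusPairIntegral rankinSelbergTorusIntegral
  simp_rw [torusPairIntegrand_self_star hΦ]
  rw [integral_complex_ofReal, integral_toReal (measurable_torusIntegrand hW hΦm σ).aemeasurable
    (ae_lt_top (measurable_torusIntegrand hW hΦm σ) hfin)]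

/-- The real-point integral as a Bochner integral of `‖W‖² Φ w` (finite case). [folklore] -/
theorem toReal_rankinSelbergTorusIntegral_eq_integral (νA : Measure (Fin n → ideleGroup K))
    (νK : Measure ↥(maximalCompactAdelic n K)) {W : GL (Fin n) (AdeleRing (𝓞 K) K) → ℂ}
    (hW : Continuous W) {Φ : (Fin n → AdeleRing (𝓞 K) K) → ℝ} (hΦ : ∀ y, 0 ≤ Φ y)
    (hΦm : Measurable fun g : GL (Fin n) (AdeleRing (𝓞 K) K) => Φ (lastRow n K g)) (σ : ℝ)
    (hfin : rankinSelbergTorusIntegral n K νA νK W Φ σ ≠ ⊤) :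
    (rankinSelbergTorusIntegral n K νA νK W Φ σ).toReal =
      ∫ p, ‖W (torusPoint n K p)‖ ^ 2 * (Φ (lastRow n K (torusPoint n K p)) * torusWeight n K σ p.1)
        ∂(νA.prod νK) := by
  simp_rw [norm_sq_mul_eq_toReal_torusIntegrand hΦ]
  unfold rankinSelbergTorusIntegral
  rw [integral_toReal (measurable_torusIntegrand hW hΦm σ).aemeasurable
    (ae_lt_top (measurable_torusIntegrand hW hΦm σ) hfin)]

end PairLemmas

/-! ### The unfolding identity for pairs -/

section Unfolding

variable {n : ℕ} {K : Type} [Field K] [NumberField K]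
variable [MeasurableSpace (ideleGroup K)] [BorelSpace (ideleGroup K)]

attribute [local instance] adelicBorel borelSpace_adelic glAdeleBorel borelSpace_glAdele

omit [MeasurableSpace (ideleGroup K)] [BorelSpace (ideleGroup K)] in
/-- **`W_{φ + c φ'} = W_φ + c W_{φ'}`** for continuous `φ`, `φ'` (linearity of the global Whittaker
coefficient on the Tate box; integrability from continuity). [folklore] -/
theorem whittakerCoeff_add_const_smul (ν₀ : Measure ↥(adelicUnipotent n K)) [IsFiniteMeasureOnCompacts ν₀]
    {φ φ' : GL (Fin n) (AdeleRing (𝓞 K) K) → ℂ} (hφ : Continuous φ) (hφ' : Continuous φ') (c : ℂ)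
    (g : GL (Fin n) (AdeleRing (𝓞 K) K)) :
    whittakerCoeff ν₀ (unipotentTateDomain n K) (adeleAddChar K) (φ + c • φ') g =
      whittakerCoeff ν₀ (unipotentTateDomain n K) (adeleAddChar K) φ g +
        c * whittakerCoeff ν₀ (unipotentTateDomain n K) (adeleAddChar K) φ' g := by
  rw [whittakerCoeff_add ν₀ _ _ g
    (integrableOn_whittakerIntegrand_of_continuous (isCompact_closure_unipotentTateDomain (n := n) (K := K))
      (continuous_adeleAddChar K) hφ g)
    (integrableOn_whittakerIntegrand_of_continuous (isCompact_closure_unipotentTateDomain (n := n) (K := K))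
      (continuous_adeleAddChar K) (hφ'.const_smul c) g), whittakerCoeff_const_smul]

/-- `‖a + c b‖² ≤ 2 ‖a‖² + 2 ‖c‖² ‖b‖²`, in `[0, ∞]` form for the mean squares. [folklore] -/
theorem ofReal_norm_add_mul_sq_le (a b c : ℂ) :
    ENNReal.ofReal (‖a + c * b‖ ^ 2) ≤ 2 * ENNReal.ofReal (‖a‖ ^ 2) + 2 * ENNReal.ofReal (‖c‖ ^ 2 * ‖b‖ ^ 2) := by
  have h : ‖a + c * b‖ ^ 2 ≤ 2 * ‖a‖ ^ 2 + 2 * (‖c‖ ^ 2 * ‖b‖ ^ 2) := by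
    have h1 : ‖a + c * b‖ ≤ ‖a‖ + ‖c‖ * ‖b‖ := (norm_add_le _ _).trans (by rw [norm_mul])
    have h2 : 0 ≤ ‖a‖ + ‖c‖ * ‖b‖ := by positivity
    nlinarith [sq_nonneg (‖a‖ - ‖c‖ * ‖b‖), norm_nonneg (a + c * b)]
  calc ENNReal.ofReal (‖a + c * b‖ ^ 2) ≤ ENNReal.ofReal (2 * ‖a‖ ^ 2 + 2 * (‖c‖ ^ 2 * ‖b‖ ^ 2)) :=
        ENNReal.ofReal_le_ofReal h
    _ = 2 * ENNReal.ofReal (‖a‖ ^ 2) + 2 * ENNReal.ofReal (‖c‖ ^ 2 * ‖b‖ ^ 2) := by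
        rw [ENNReal.ofReal_add (by positivity) (by positivity), ENNReal.ofReal_mul zero_le_two,
          ENNReal.ofReal_mul zero_le_two, ENNReal.ofReal_ofNat]

/-- **Finiteness of the mean square of `φ + c φ'` against a weight** from that of `φ` and `φ'`. [folklore] -/
theorem lintegral_normSq_add_smul_ne_top {X : Type*} [MeasurableSpace X] (m : Measure X)
    {φ φ' : X → ℂ} {w : X → ℝ≥0∞} (hφm : Measurable φ) (hφ'm : Measurable φ') (hw : Measurable w)
    (h : ∫⁻ x, ENNReal.ofReal (‖φ x‖ ^ 2) * w x ∂m ≠ ⊤) (h' : ∫⁻ x, ENNReal.ofReal (‖φ' x‖ ^ 2) * w x ∂m ≠ ⊤)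
    (c : ℂ) : ∫⁻ x, ENNReal.ofReal (‖(φ + c • φ') x‖ ^ 2) * w x ∂m ≠ ⊤ := by
  have hle : ∫⁻ x, ENNReal.ofReal (‖(φ + c • φ') x‖ ^ 2) * w x ∂m ≤
      2 * ∫⁻ x, ENNReal.ofReal (‖φ x‖ ^ 2) * w x ∂m +
        2 * ENNReal.ofReal (‖c‖ ^ 2) * ∫⁻ x, ENNReal.ofReal (‖φ' x‖ ^ 2) * w x ∂m := by
    have hm1 : Measurable fun x => ENNReal.ofReal (‖φ x‖ ^ 2) * w x :=
      (ENNReal.measurable_ofReal.comp (hφm.norm.pow_const 2)).mul hw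
    have hm2 : Measurable fun x => ENNReal.ofReal (‖φ' x‖ ^ 2) * w x :=
      (ENNReal.measurable_ofReal.comp (hφ'm.norm.pow_const 2)).mul hw
    calc ∫⁻ x, ENNReal.ofReal (‖(φ + c • φ') x‖ ^ 2) * w x ∂m
        ≤ ∫⁻ x, (2 * (ENNReal.ofReal (‖φ x‖ ^ 2) * w x) +
            2 * ENNReal.ofReal (‖c‖ ^ 2) * (ENNReal.ofReal (‖φ' x‖ ^ 2) * w x)) ∂m := by
          refine lintegral_mono fun x => ?_
          have := ofReal_norm_add_mul_sq_le (φ x) (φ' x) c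
          simp only [Pi.add_apply, Pi.smul_apply, smul_eq_mul]
          calc ENNReal.ofReal (‖φ x + c * φ' x‖ ^ 2) * w x
              ≤ (2 * ENNReal.ofReal (‖φ x‖ ^ 2) + 2 * ENNReal.ofReal (‖c‖ ^ 2 * ‖φ' x‖ ^ 2)) * w x :=
                mul_le_mul' this le_rfl
            _ = _ := by rw [ENNReal.ofReal_mul (sq_nonneg _)]; ring
      _ = _ := by
          rw [lintegral_add_left (hm1.const_mul 2), lintegral_const_mul _ hm1, lintegral_const_mul _ hm2]
  refine ne_top_of_le_ne_top ?_ hle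
  exact ENNReal.add_ne_top.2 ⟨ENNReal.mul_ne_top ENNReal.ofNat_ne_top h,
    ENNReal.mul_ne_top (ENNReal.mul_ne_top ENNReal.ofNat_ne_top ENNReal.ofReal_ne_top) h'⟩

/-- **The unfolded integral of a cusp form is finite when the incomplete-Eisenstein mean square is**
(the one-form identity `C Ψ(σ; W_φ, W̄_φ, Φ) = ∫ ‖φ‖² E_w β` with `C ≠ 0`). [folklore] -/
theorem rankinSelbergTorusIntegral_ne_top_of_unfolding {C T R : ℝ≥0∞} (hC0 : C ≠ 0) (h : C * T = R)
    (hR : R ≠ ⊤) : T ≠ ⊤ := by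
  intro hT
  rw [hT, ENNReal.mul_top hC0] at h
  exact hR h.symm

/-- **The Rankin–Selberg unfolding identity for a PAIR of cusp forms at a real point**
(Jacquet–Shalika (1981), §4, (4.4); Cogdell (2004), §2.3, Thm. 2.1: `I(s; φ, φ', Φ) = Ψ(s; W_φ, W'_{φ'}, Φ)`,
in the tree's covering-weight form and normalisations). Let `0 < n`, `ν`, `νA`, `νK`, `ν₀` Haar measures
on `GL_n(𝔸_K)`, `(𝔸_Kˣ)ⁿ`, `K = maximalCompactAdelic`, `N_n(𝔸_K)`, and `C ∈ (0, ∞)` the constant of the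
one-form identity `exists_mul_rankinSelbergTorusIntegral_eq_lintegral_eisensteinWeight`. Then for all
`φ`, `φ' : GL_n(𝔸_K) → ℂ` continuous, left `GL_n(K)`-invariant and **cuspidal**, every `Φ ≥ 0` with
`g ↦ Φ(e_n g)` measurable and `E_w = eisensteinWeight Φ σ` measurable, every measurable `GL_n(K)`-covering
weight `β` with `∫ ‖φ‖² E_w β dν < ∞` and `∫ ‖φ'‖² E_w β dν < ∞`:

  `C · Ψ(σ; W_φ, W̄_{φ'}, Φ) = ∫ φ φ̄' (E_w β) dν`  in `ℂ`,

`W_φ = whittakerCoeff ν₀ (unipotentTateDomain n K) (adeleAddChar K) φ`, `W̄_{φ'} = star W_{φ'}`. Proof: the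
one-form identity for the four cusp forms `φ + c φ'`, `c ∈ {1, -1, i, -i}` (all finite,
`lintegral_normSq_add_smul_ne_top`, hence so are their unfolded integrals), `W_{φ + c φ'} = W_φ + c W_{φ'}`,
and the polarization identity on both sides (`integral_mul_conj_mul_eq_polarization`).
[cite: CogdellAnalyticTheory2004, §2.3 Thm. 2.1] -/
theorem exists_mul_rankinSelbergTorusPairIntegral_eq_integral_eisensteinWeight (hn : 0 < n)
    (ν : Measure (GL (Fin n) (AdeleRing (𝓞 K) K))) [IsHaarMeasure ν]
    (νA : Measure (Fin n → ideleGroup K)) [IsHaarMeasure νA]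
    (νK : Measure ↥(maximalCompactAdelic n K)) [IsHaarMeasure νK]
    (ν₀ : Measure ↥(adelicUnipotent n K)) [IsHaarMeasure ν₀] :
    ∃ C : ℝ≥0∞, C ≠ 0 ∧ C ≠ ⊤ ∧
      (∀ {φ : GL (Fin n) (AdeleRing (𝓞 K) K) → ℂ}, Continuous φ →
        (∀ (γ₀ : GL (Fin n) K) (x : GL (Fin n) (AdeleRing (𝓞 K) K)),
          φ (Matrix.GeneralLinearGroup.map (algebraMap K (AdeleRing (𝓞 K) K)) γ₀ * x) = φ x) →
        (∀ k, 0 < k → k < n → CuspConditionGL n K φ k) →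
      ∀ {Φ : (Fin n → AdeleRing (𝓞 K) K) → ℝ}, (∀ y, 0 ≤ Φ y) →
        (Measurable fun g : GL (Fin n) (AdeleRing (𝓞 K) K) => Φ (lastRow n K g)) →
      ∀ (σ : ℝ) {βG : GL (Fin n) (AdeleRing (𝓞 K) K) → ℝ≥0∞}, Measurable βG →
        (∀ x, coveringSum ↥(ratPoints (⊤ : Subgroup (GL (Fin n) K))) βG x = 1) →
        C * rankinSelbergTorusIntegral n K νA νK
            (whittakerCoeff ν₀ (unipotentTateDomain n K) (adeleAddChar K) φ) Φ σ =
          ∫⁻ x, ENNReal.ofReal (‖φ x‖ ^ 2) * eisensteinWeight n K Φ σ x * βG x ∂ν) ∧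
      ∀ {φ φ' : GL (Fin n) (AdeleRing (𝓞 K) K) → ℂ}, Continuous φ → Continuous φ' →
        (∀ (γ₀ : GL (Fin n) K) (x : GL (Fin n) (AdeleRing (𝓞 K) K)),
          φ (Matrix.GeneralLinearGroup.map (algebraMap K (AdeleRing (𝓞 K) K)) γ₀ * x) = φ x) →
        (∀ (γ₀ : GL (Fin n) K) (x : GL (Fin n) (AdeleRing (𝓞 K) K)),
          φ' (Matrix.GeneralLinearGroup.map (algebraMap K (AdeleRing (𝓞 K) K)) γ₀ * x) = φ' x) →
        (∀ k, 0 < k → k < n → CuspConditionGL n K φ k) →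
        (∀ k, 0 < k → k < n → CuspConditionGL n K φ' k) →
      ∀ {Φ : (Fin n → AdeleRing (𝓞 K) K) → ℝ}, (∀ y, 0 ≤ Φ y) →
        (Measurable fun g : GL (Fin n) (AdeleRing (𝓞 K) K) => Φ (lastRow n K g)) →
      ∀ (σ : ℝ), Measurable (eisensteinWeight n K Φ σ) →
      ∀ {βG : GL (Fin n) (AdeleRing (𝓞 K) K) → ℝ≥0∞}, Measurable βG →
        (∀ x, coveringSum ↥(ratPoints (⊤ : Subgroup (GL (Fin n) K))) βG x = 1) →
        ∫⁻ x, ENNReal.ofReal (‖φ x‖ ^ 2) * eisensteinWeight n K Φ σ x * βG x ∂ν ≠ ⊤ →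
        ∫⁻ x, ENNReal.ofReal (‖φ' x‖ ^ 2) * eisensteinWeight n K Φ σ x * βG x ∂ν ≠ ⊤ →
        (C.toReal : ℂ) * rankinSelbergTorusPairIntegral n K νA νK
            (whittakerCoeff ν₀ (unipotentTateDomain n K) (adeleAddChar K) φ)
            (star (whittakerCoeff ν₀ (unipotentTateDomain n K) (adeleAddChar K) φ')) Φ σ =
          ∫ x, φ x * conj (φ' x) * (((eisensteinWeight n K Φ σ x * βG x).toReal : ℝ) : ℂ) ∂ν := by
  haveI : T2Space (GL (Fin n) (AdeleRing (𝓞 K) K)) := t2Space_gl n K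
  haveI : LocallyCompactSpace (GL (Fin n) (AdeleRing (𝓞 K) K)) :=
    AdelicGroupData.locallyCompactSpace_generalLinearGroup_adeleRing K (Fin n)
  haveI : SecondCountableTopology (GL (Fin n) (AdeleRing (𝓞 K) K)) :=
    secondCountableTopology_generalLinearGroup_adeleRing K (Fin n)
  obtain ⟨C, hC0, hCtop, hU⟩ :=
    exists_mul_rankinSelbergTorusIntegral_eq_lintegral_eisensteinWeight (n := n) (K := K) hn ν νA νK ν₀
  refine ⟨C, hC0, hCtop, fun hφ hφK hcusp Φ hΦ0 hΦm σ βG hβGm hβG => hU hφ hφK hcusp hΦ0 hΦm σ hβGm hβG, ?_⟩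
  intro φ φ' hφ hφ' hφK hφ'K hcusp hcusp' Φ hΦ0 hΦm σ hEm βG hβGm hβG hR hR'
  -- notation
  set W : (GL (Fin n) (AdeleRing (𝓞 K) K) → ℂ) → GL (Fin n) (AdeleRing (𝓞 K) K) → ℂ :=
    fun ψ => whittakerCoeff ν₀ (unipotentTateDomain n K) (adeleAddChar K) ψ with hWdef
  set E : GL (Fin n) (AdeleRing (𝓞 K) K) → ℝ≥0∞ := fun x => eisensteinWeight n K Φ σ x * βG x with hE
  have hEm' : Measurable E := hEm.mul hβGm
  -- the four combinations `φ + c φ'`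
  have hcomb : ∀ c : ℂ, Continuous (φ + c • φ') ∧
      (∀ (γ₀ : GL (Fin n) K) (x : GL (Fin n) (AdeleRing (𝓞 K) K)),
        (φ + c • φ') (Matrix.GeneralLinearGroup.map (algebraMap K (AdeleRing (𝓞 K) K)) γ₀ * x) =
          (φ + c • φ') x) ∧
      (∀ k, 0 < k → k < n → CuspConditionGL n K (φ + c • φ') k) := fun c =>
    ⟨hφ.add (hφ'.const_smul c), fun γ₀ x => by simp only [Pi.add_apply, Pi.smul_apply, hφK, hφ'K],
      fun k hk hkn => (hcusp k hk hkn).add ((hcusp' k hk hkn).smul c)⟩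
  -- the one-form identity for `φ + c φ'`, all finite
  have hRc : ∀ c : ℂ, ∫⁻ x, ENNReal.ofReal (‖(φ + c • φ') x‖ ^ 2) * E x ∂ν ≠ ⊤ := fun c => by
    have h1 : ∫⁻ x, ENNReal.ofReal (‖φ x‖ ^ 2) * E x ∂ν ≠ ⊤ := by simpa only [hE, mul_assoc] using hR
    have h2 : ∫⁻ x, ENNReal.ofReal (‖φ' x‖ ^ 2) * E x ∂ν ≠ ⊤ := by simpa only [hE, mul_assoc] using hR'
    exact lintegral_normSq_add_smul_ne_top ν hφ.measurable hφ'.measurable hEm' h1 h2 c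
  have hUc : ∀ c : ℂ, C * rankinSelbergTorusIntegral n K νA νK (W (φ + c • φ')) Φ σ =
      ∫⁻ x, ENNReal.ofReal (‖(φ + c • φ') x‖ ^ 2) * E x ∂ν := fun c => by
    obtain ⟨h1, h2, h3⟩ := hcomb c
    simpa only [hE, mul_assoc] using hU h1 h2 h3 hΦ0 hΦm σ hβGm hβG
  have hTc : ∀ c : ℂ, rankinSelbergTorusIntegral n K νA νK (W (φ + c • φ')) Φ σ ≠ ⊤ := fun c =>
    rankinSelbergTorusIntegral_ne_top_of_unfolding hC0 (hUc c) (hRc c)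
  -- the Whittaker coefficients of the combinations
  have hWc : ∀ c : ℂ, W (φ + c • φ') = fun g => W φ g + c * W φ' g := fun c =>
    funext fun g => whittakerCoeff_add_const_smul ν₀ hφ hφ' c g
  have hWφc : Continuous (W φ) := continuous_whittakerCoeff (measurableSet_unipotentTateDomain (n := n) (K := K))
    (isCompact_closure_unipotentTateDomain (n := n) (K := K)) (continuous_adeleAddChar K) hφ
  have hWφ'c : Continuous (W φ') := continuous_whittakerCoeff (measurableSet_unipotentTateDomain (n := n) (K := K))
    (isCompact_closure_unipotentTateDomain (n := n) (K := K)) (continuous_adeleAddChar K) hφ'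
  have hWcc : ∀ c : ℂ, Continuous (W (φ + c • φ')) := fun c => by
    rw [hWc c]; exact hWφc.add (continuous_const.mul hWφ'c)
  -- measurability of the mean-square integrands
  have hmc : ∀ c : ℂ, Measurable fun x => ENNReal.ofReal (‖(φ + c • φ') x‖ ^ 2) * E x := fun c =>
    (ENNReal.measurable_ofReal.comp ((hcomb c).1.measurable.norm.pow_const 2)).mul hEm'
  -- the real identities for the combinations
  set w : (Fin n → ideleGroup K) × ↥(maximalCompactAdelic n K) → ℝ := fun p =>
    Φ (lastRow n K (torusPoint n K p)) * torusWeight n K σ p.1 with hw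
  have hreal : ∀ c : ℂ, C.toReal * ∫ p, ‖W φ (torusPoint n K p) + c * W φ' (torusPoint n K p)‖ ^ 2 * w p ∂(νA.prod νK) =
      ∫ x, ‖φ x + c * φ' x‖ ^ 2 * (E x).toReal ∂ν := fun c => by
    have h := congrArg ENNReal.toReal (hUc c)
    rw [ENNReal.toReal_mul, toReal_rankinSelbergTorusIntegral_eq_integral νA νK (hWcc c) hΦ0 hΦm σ (hTc c),
      ← integral_toReal (hmc c).aemeasurable (ae_lt_top (hmc c) (hRc c))] at h
    have h1 : (fun p => ‖W (φ + c • φ') (torusPoint n K p)‖ ^ 2 * w p) =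
        fun p => ‖W φ (torusPoint n K p) + c * W φ' (torusPoint n K p)‖ ^ 2 * w p := by
      funext p; rw [hWc c]
    have h2 : (fun x => (ENNReal.ofReal (‖(φ + c • φ') x‖ ^ 2) * E x).toReal) =
        fun x => ‖φ x + c * φ' x‖ ^ 2 * (E x).toReal := by
      funext x
      rw [ENNReal.toReal_mul, ENNReal.toReal_ofReal (sq_nonneg _)]
      simp only [Pi.add_apply, Pi.smul_apply, smul_eq_mul]
    rw [h1, h2] at h
    exact h
  -- integrability of the four real integrands on both sides
  have hintT : ∀ c : ℂ, Integrable (fun p => ‖W φ (torusPoint n K p) + c * W φ' (torusPoint n K p)‖ ^ 2 * w p)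
      (νA.prod νK) := fun c => by
    have h := integrable_toReal_torusIntegrand νA νK (hWcc c) hΦm σ (hTc c)
    have h1 : (fun p => (torusIntegrand n K (W (φ + c • φ')) Φ σ p).toReal) =
        fun p => ‖W φ (torusPoint n K p) + c * W φ' (torusPoint n K p)‖ ^ 2 * w p := by
      funext p; rw [← norm_sq_mul_eq_toReal_torusIntegrand hΦ0, hWc c]
    rwa [h1] at h
  have hintR : ∀ c : ℂ, Integrable (fun x => ‖φ x + c * φ' x‖ ^ 2 * (E x).toReal) ν := fun c => by
    have h := integrable_toReal_of_lintegral_ne_top (hmc c).aemeasurable (hRc c)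
    have h2 : (fun x => (ENNReal.ofReal (‖(φ + c • φ') x‖ ^ 2) * E x).toReal) =
        fun x => ‖φ x + c * φ' x‖ ^ 2 * (E x).toReal := by
      funext x
      rw [ENNReal.toReal_mul, ENNReal.toReal_ofReal (sq_nonneg _)]
      simp only [Pi.add_apply, Pi.smul_apply, smul_eq_mul]
    rwa [h2] at h
  -- polarization on both sides
  have hL : rankinSelbergTorusPairIntegral n K νA νK (W φ) (star (W φ')) Φ σ =
      ∫ p, W φ (torusPoint n K p) * conj (W φ' (torusPoint n K p)) * (w p : ℂ) ∂(νA.prod νK) := by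
    unfold rankinSelbergTorusPairIntegral torusPairIntegrand
    rfl
  have e1 := hintT 1; have e2 := hintT (-1); have e3 := hintT Complex.I; have e4 := hintT (-Complex.I)
  have f1 := hintR 1; have f2 := hintR (-1); have f3 := hintR Complex.I; have f4 := hintR (-Complex.I)
  have r1 := hreal 1; have r2 := hreal (-1); have r3 := hreal Complex.I; have r4 := hreal (-Complex.I)
  simp only [one_mul, neg_mul, ← sub_eq_add_neg] at e1 e2 e3 e4 f1 f2 f3 f4 r1 r2 r3 r4
  rw [hL, integral_mul_conj_mul_eq_polarization e1 e2 e3 e4,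
    integral_mul_conj_mul_eq_polarization f1 f2 f3 f4, ← r1, ← r2, ← r3, ← r4]
  push_cast
  ring

end Unfolding

end Literature.NumberTheory.Automorphic
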